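import Summits.AtomisticToContinuum.BoseEinsteinCondensation.Theorems.BoxLatticeFSumDCTPlancherel
import Summits.AtomisticToContinuum.BoseEinsteinCondensation.Theorems.BlockLatticeFSumKinematics
import HarnessLib

/-!
# DCT Parseval on the block span of the box: `Σ_q n(g_q) = Σ_B n(u_B)`  (kernel (i) of MC, decomp-a2c · hand-1 g9)

Step (i) of the support piece MC = `BoxShellModeCounting` of the `BoxLatticeFSum` carving (lens-6 g29): for
every continuous `Ψ` on `(ℝ³)^{n+1}`, every `K > 0` and side `L`,
`Σ_{q} cellOccupation (n+1) L (boxBlockWave L K q) Ψ = Σ_{B} cellOccupation (n+1) L (subMode (L/K) B) Ψ` —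
the DCT-II block waves `g_q = Σ_B dctCoeff K q B · u_B` and the sub-cell modes `u_B` carry the same total
cell occupation.  Proof: conjugate-linearity of the slice amplitude (`Kinematics.modeAn_finset_sum_mode`), the
coefficient Plancherel `dct_plancherel`, and the pointwise-to-integrated transfer
`Kinematics.cellOccupation_transfer_eq`.  (For a Dirichlet trial state the plain `occupation` of MC's
statement agrees with `cellOccupation`; that bridge is not in this file.)  No definitions, no `sorry`.
[folklore]
-/

noncomputable section

open MeasureTheory Finset
open scoped BigOperators ComplexConjugate ENNReal

namespace Summit.AtomisticToContinuum.BoseEinsteinCondensation.Theorems.BoxLatticeFSum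

open Literature.MathematicalPhysics.QuantumManyBody.BoseGas
open Summit.AtomisticToContinuum.BoseEinsteinCondensation.Theses.BlockLatticeFSum

/-- The sub-cell mode is bounded by its constant value. [folklore] -/
theorem norm_subMode_le {k : ℕ} (ℓ : ℝ) (B : SubIdx k) (x : Space) :
    ‖subMode ℓ B x‖ ≤ ‖((Real.sqrt (ℓ ^ 3))⁻¹ : ℂ)‖ := by
  rw [subMode_eq_indicator]
  exact norm_indicator_le_norm_self _ _

/-- The sub-cell mode is measurable. [folklore] -/
theorem measurable_subMode {k : ℕ} (ℓ : ℝ) (B : SubIdx k) : Measurable (subMode ℓ B) := by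
  rw [subMode_eq_indicator]
  exact measurable_const.indicator (measurableSet_subCell ℓ B)

/-- The DCT block wave is measurable. [folklore] -/
theorem measurable_boxBlockWave (L : ℝ) (K : ℕ) (q : SubIdx K) : Measurable (boxBlockWave L K q) := by
  unfold boxBlockWave
  exact Finset.measurable_sum _ fun B _ => measurable_const.mul (measurable_subMode _ B)

/-- The slice amplitude of a DCT block wave is the DCT transform of the sub-cell slice amplitudes:
`a(g_q)Ψ = Σ_B dctCoeff K q B · a(u_B)Ψ` (real coefficients). [folklore] -/
theorem modeAn_boxBlockWave {n : ℕ} {L : ℝ} {K : ℕ} (q : SubIdx K) {Ψ : Config (n + 1) → ℂ}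
    (hΨ : Continuous Ψ) (Y : Config n) :
    modeAn L (boxBlockWave L K q) Ψ Y =
      ∑ B : SubIdx K, ((dctCoeff K q B : ℝ) : ℂ) * modeAn L (subMode (L / (K : ℝ)) B) Ψ Y := by
  have h := Kinematics.modeAn_finset_sum_mode (L := L) (Finset.univ : Finset (SubIdx K))
    (fun B => ((dctCoeff K q B : ℝ) : ℂ)) (fun B => subMode (L / (K : ℝ)) B)
    (fun B => measurable_subMode _ B) (fun B => ⟨_, fun x => norm_subMode_le _ B x⟩) hΨ Y
  have hfun : boxBlockWave L K q = fun x => ∑ B : SubIdx K, ((dctCoeff K q B : ℝ) : ℂ) * subMode (L / (K : ℝ)) B x := by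
    funext x; rfl
  rw [hfun, h]
  refine Finset.sum_congr rfl fun B _ => ?_
  rw [Complex.conj_ofReal]

/-- **DCT Parseval on the block span**: `Σ_q n(g_q) = Σ_B n(u_B)` for the cell occupations of every continuous
`Ψ`. [folklore] -/
theorem parseval_boxBlockWaves {n : ℕ} {L : ℝ} {K : ℕ} (hK : 0 < K) {Ψ : Config (n + 1) → ℂ}
    (hΨ : Continuous Ψ) :
    ∑ q : SubIdx K, cellOccupation (n + 1) L (boxBlockWave L K q) Ψ =
      ∑ B : SubIdx K, cellOccupation (n + 1) L (subMode (L / (K : ℝ)) B) Ψ := by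
  have h := Kinematics.cellOccupation_transfer_eq (L := L) Finset.univ Finset.univ
    (fun _ => (1 : ℝ)) (fun _ => (1 : ℝ)) (fun _ _ => zero_le_one) (fun _ _ => zero_le_one)
    (fun q : SubIdx K => boxBlockWave L K q) (fun B : SubIdx K => subMode (L / (K : ℝ)) B)
    (fun q => measurable_boxBlockWave L K q) (fun B => measurable_subMode _ B) hΨ ?_
  · simpa using h
  intro Y _
  simp only [one_mul]
  simp_rw [modeAn_boxBlockWave _ hΨ Y]
  exact dct_plancherel hK fun B => modeAn L (subMode (L / (K : ℝ)) B) Ψ Y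

end Summit.AtomisticToContinuum.BoseEinsteinCondensation.Theorems.BoxLatticeFSum

end
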